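import Summits.BirchSwinnertonDyer.Rank1Residual.O5.O5KummerLine
import HarnessLib

/-!
# O5 — the TWISTED tame supersingular local classes at `3`: one universal Kummer line per Kodaira symbol

Typed `@[conjecture]` nodes T20 / T21 / T22 drafted by o5-r1 GEN 6 (planner-b2b-bsdres-o5-r1-g6-0, 2026-08-21) for
the cc-typer seat to land (ask A-O5-18).  HONEST FRAMING: census output is EVIDENCE; the derivations in
`HOME/b2b-bsdres-o5-r1/gen6/T19-PROOF-v2.md` (Thms 2–4) are THEOREM-CANDIDATES pending an independent check
(harvest-2, R5–R7); every node below keeps its `@[conjecture]` tag until a kernel proof; nothing here is a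
Literature fact; nothing booked; no RESIDUAL-MAP mark moves.

SETTING.  A tame additive potentially supersingular curve `W/ℚ₃` (`e = 4` for O5b = (t′), `e = 2` for O5a = (G) ∧ ss)
with `W[3]|G_{ℚ₃}` irreducible has `W[3]|G_{ℚ₃} ≅ V₀ ⊗ ω^{?}` where `V₀` is the (unique, T19a) flat supersingular class.
v2 Thm 2 (inertial exponent; independently harvest-2 E88 §6.2 'FML-local' for `m ∈ {1, 3}`): with `m := v₃(Δ_min)/3`,
inertia acts through `ω₂^{1−2m}`, so good-ss (`m = 0`) and III* (`m = 3`) carry `V₀`, while III (`m = 1`) and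
I₀*-ss (`m = 2`) carry `V₁ := V₀ ⊗ ω`.  On `V₀` the Kummer line is the flat line `ℓ₁*` for every such curve
(T19 `KummerLineUniversalThree`, derived gen 5, checked R1–R4 by harvest-2 E88).  On `V₁` there is no flat line;
v2 Thm 3 computes the conductor exponent of the Kummer torsor from the formal valuation `t` of the base point on the
good model over `ℚ₃(3^{1/4})` — upper break `s = 9 − 8t`, torsor discriminant `d3 = s + 8` — giving III ↦ `s = 7`,
`d3 = 15` and I₀*-ss ↦ `s = 5`, `d3 = 13`; v2 Thm 4 (Hilbert symbols `(U_i, U_j)_3 = 1` for `i + j > 12` in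
`ℚ₉(3^{1/8})`, Serre *Local Fields* XV §3 Prop. 6 / Ex. 3) makes the conductor-5 line `ℓ₅*` isotropic, whence the
conductor-7 part of the local condition is ONE isotropic line `ℓ₇^iso`.  Consequences typed below:
T20 — every Kodaira-III curve with irreducible local `W[3]` has the SAME Kummer torsor class (`ℓ₇^iso`);
T21 — every I₀*-ss curve has the SAME Kummer torsor class (`ℓ₅*`), whether its good twist has `a₃ = 0` or `a₃ = ±3`;
T22 — the two `V₁`-classes differ (`ℓ₇^iso ≠ ℓ₅*`).
Together with T19 / T18″ this says: at a tame supersingular `3` the local Kummer condition is a CONSTANT of the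
Kodaira symbol (`ℓ₁*`, `ℓ₁*`, `ℓ₇^iso`, `ℓ₅*` on good-ss / III* / III / I₀*-ss), the input o5-r2's Selmer-structure
comparisons over families with fixed `ρ̄` may treat as fixed.

CENSUS (EVIDENCE; pre-registered `HOME/b2b-bsdres-o5-r1/gen6/P-K11-PREREG.md`, sha16 865ebe31 frozen BEFORE kit j135074;
instrument = gen-5 KUM3LOC `lib_k10.gp` verbatim + two generators; frozen scorer `k11_score.py`; 771 tasks, 14 346 rows,
0 errors): OVERALL PASS with 0 counter-verdicts — `d3 = 13`, `(e,f) = (9,1)` on ALL 9 744 census I₀*-ss rows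
(O5a₀ 5 906 + O5a± 3 838; the value 13 had never occurred before and was predicted) and on 750 / 750 random local
I₀*-ss curves; `d3 = 15` on 750 / 750 random local III curves; I₀* ~ I₀* KUM-EQUAL 900 / 900 (400 census, incl. 200
O5a± rows against the O5a₀ reference 3870t1, + 500 random); III ~ III KUM-EQUAL 900 / 900 (reference 153a1);
III ~ I₀* KUM-DIFFERENT 902 / 902; RHOBAR-MISMATCH 0 and 3-division pattern `[4, 4, 8]` on all 3 102 pairs (one class `V₁`).
Earlier controls (gen 5, P-K7b / P-K10): III ~ good-ss and III ~ III* never agree (550 + 300 pairs), `d3 ∈ {9, 15}` on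
154 810 III*/III rows.

NOT IN PRINT as statements (searched gen 4–6: Mazur–Rubin 2015 Rem. 5.9 / Česnavičius 2016 §2 stop at semiabelian
reduction at `v ∣ p`; Poonen–Rains 2012 Prop. 4.12 is good reduction; CDT 1999 §§4–5 / Savitt 2005 classify the
Galois types, not the Kummer line).  Base-point independence: for `W[3](ℚ₃) = 0` (automatic when `W[3]|G_{ℚ₃}` is
irreducible) `W(ℚ₃) ⊗ 𝔽₃` is a line, so the torsor class of `[3]⁻¹P` does not depend on the admissible `P`.

## TYPER PLACEMENT NOTE (cc-typer-5 GEN 8, typer of record O5 §3.5, 2026-08-21)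

HONEST FRAMING (cell `b2b-bsdres`, run/shared/lean/b2b/bsd-rank1-residual/, verbatim in every
file): the goal of the cell is to DELETE the COMBINATION-SHAPED residual classes of the
Birch–Swinnerton-Dyer formula for ALL analytic-rank `≤ 1` elliptic curves over `ℚ` — assembled
STRICTLY from published theorems — so that the rank-`≤ 1` remainder becomes exactly the
CONSTRUCTION-SHAPED classes, which are TYPED (missing-input `Prop`s), NOT attempted. This is not
"finishing BSD". Lane CLASS-CLOSURE (`CLASS-CLOSURE-PLAN.md` §3.5 O5): research routes; no claim beyond
the stated classes; census output is EVIDENCE / conjecture items, never a Literature fact; nothing is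
booked; no mark of `RESIDUAL-MAP.md` moves. NO Literature fact is minted here.

PROVENANCE. The module text above this note and the three declarations below are o5-r1 GEN 6's draft
`HOME/b2b-bsdres-o5-r1/gen6/O5KummerLineTwisted.lean` (sha16 `345659de04964019`, 101 lines; typing ask A-O5-18 (a),
`HOME/INBOX.md` 2026-08-21T16:46Z; `cells/o5o6/TARGETS.md` §O5 '#### o5-r1 GEN 6'; derivation
`gen6/T19-PROOF-v2.md` sha16 `4096abf768197445`), with the statements BYTE-IDENTICAL and three additions: the
`import HarnessLib` line, this note, and one CHECK sentence per docstring recording the independent check that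
has since happened — **harvest-2 GEN 42, E90 (`HOME/b2b-bsdres-harvest-2/gen42/E90-T19v2-check.md`, sha16
`6aa1eb9937515da2`; `HOME/INBOX.md` 2026-08-21T17:21Z): R5 (v2 Thm 2, all four `m`, incl. `m = 2`) ✓, R6 (v2 Thm 3,
Newton polygon of `[3]T − T_K(P)`, break `9 − 8t`, `d3 = s + 8`) ✓, R7 (v2 Thm 4, Serre XV §3 Prop. 6 + Ex. 3 re-read
at the page, Lagrangian count) ✓, Lemma 2.4 ✓, with two precisions (R5-i: the vertex set of the Newton polygon of
`[3]/T` from AEC IV Cor. 4.4 + the subgroup count; R5-ii: 'Tate-normalised' model) that change no statement; second-seat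
numerics kit j135711 (harvest-2's own GP, six I₀*-ss curves ↦ `(e,f) = (9,1)`, `d3 = 13`; controls good-ss ↦ 9,
III ↦ 15, III* ↦ 9).**  So T20 / T21 / T22 are THEOREM-CANDIDATES with a written proof checked by a second seat;
by the lane lead's ruling (cc-lead ⟦gen22⟧ (8)(b), ⟦gen23⟧ (8)(c): tags track KERNEL status) each keeps the
`@[conjecture]` tag until a kernel proof lands — the tag marks an open obligation node of the cell, it does not
demote the written proof.

READING OF THE DECLARATIONS (audit classes as in `O5KummerLine.lean`): three closed `@[conjecture] def … : Prop`
over the tree's predicates `Additive.ClassO5` / `Additive.SubTprime` (O5b = (t′), `e = 4`) / `Additive.SubGss`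
(O5a = (G) ∧ ss, `e = 2`; `PotSupersingularClasses.lean`) / `Additive.LocIrr` (`FouquetWanLocus.lean`; at `p = 3`
now DECIDED in the kernel: `O5.locIrr_three_iff_forall_not_isRoot`, harvest-2 E89 p291075, and
`Additive.locIrrThreeIffCriterion_holds`, p292696) and GEN 5's `IsKummerBasePointThree` /
`KummerTorsorsAgreeAtThree` (`O5KummerLine.lean` §1) — no new vocabulary.  The Kodaira symbol is carried, as in
GEN 5's nodes, by `padicValRat 3 W.Δ` on a globally minimal model (`= 3` III, `= 9` III*; I₀*-ss rows need no
discriminant clause: `SubGss` at `3` forces `v₃Δ_min = 6`).  Every `[cite: …]` key exists in `references.bib`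
(Serre1979, PoonenRains2012, Fontaine1985 — checked GEN 6/7).  DEDUP: `lean search 'KummerLineUniversalTypeIII\|
KummerLineUniversalIzeroStar\|KummerLineTwistedClassesDiffer'` → no match.  The companion numerical law
`d3 = 13` on I₀*-ss rows (P-K11 arm A) is typed next to P-K10 in `O5/O5TorsorDiscriminant.lean` §4 (A-O5-18 (b)).
0 Literature facts; net debt 0; nothing booked; no mark of `RESIDUAL-MAP.md` moves.
-/

open scoped Classical

open Polynomial WeierstrassCurve Literature.NumberTheory.EllipticCurves
  Summit.BirchSwinnertonDyer.Rank1Residual.Additive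

namespace Summit.BirchSwinnertonDyer.Rank1Residual.O5

/-- **T20 `KummerLineUniversalTypeIIIThree` (CONJECTURE-class; DERIVED in `gen6/T19-PROOF-v2.md` Thms 2–4 pending check).**
Any two Kodaira-III O5(t′) curves `W`, `G` over `ℚ` (`v₃(Δ_min) = 3`) whose mod-3 representations are irreducible
on `G_{ℚ₃}` have the same Kummer torsor at `3`: the stem fields `ℚ₃(R)`, `3R = P`, are isomorphic and the torsor
fields `ℚ₃(W[3], [3]⁻¹P) = ℚ₃(G[3], [3]⁻¹P′)` coincide inside `ℚ̄₃` once `W[3] ≅ G[3]` are identified (both are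
`V₁ = V₀ ⊗ ω`, v2 Thm 2; the line is the unique isotropic conductor-7 line `ℓ₇^iso`, v2 Thms 3–4).
Why it might fail: only through v2 Thm 4 (isotropy of `ℓ₅*`, a Hilbert-symbol computation in `ℚ₉(3^{1/8})`) or
Thm 3 (the break `9 − 8t`); a single KUM-DIFFERENT pair of LocIrr type-III curves refutes it.
CHECK (2026-08-21, after the draft): v2 Thms 2–4 + Lemma 2.4 CHECKED R5–R7 ✓ by harvest-2 E90
(`gen42/E90-T19v2-check.md` 6aa1eb9937515da2) — THEOREM-CANDIDATE; `@[conjecture]` tag kept until a kernel proof.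
[evidence: census cell O5, o5-r1 GEN 6, P-K11 kit j135074 arms B2 + C3r: III ~ III KUM-EQUAL 400/400 census + 500/500 random local curves, d3 = 15 on 750/750; 0 exceptions]
[cite: Serre1979, Ch. XV §2 Thm. 2, §3 Prop. 6 and Ex. 3, Ch. IV §3] [cite: PoonenRains2012, Prop. 2.9 / §4] [cite: Fontaine1985, Thm. A] -/
@[conjecture] def KummerLineUniversalTypeIIIThree : Prop :=
  ∀ (W G : WeierstrassCurve ℚ) [W.IsElliptic] [W.IsGloballyMinimal] [G.IsElliptic] [G.IsGloballyMinimal],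
    ClassO5 W 3 → SubTprime W 3 → LocIrr W 3 → padicValRat 3 W.Δ = 3 →
    ClassO5 G 3 → SubTprime G 3 → LocIrr G 3 → padicValRat 3 G.Δ = 3 →
      ∀ x y x' y' : ℚ_[3], IsKummerBasePointThree W x y → IsKummerBasePointThree G x' y' →
        KummerTorsorsAgreeAtThree W G x x'

/-- **T21 `KummerLineUniversalIzeroStarThree` (CONJECTURE-class; DERIVED in `gen6/T19-PROOF-v2.md` Thms 2–4 pending check).**
Any two O5a curves `W`, `G` over `ℚ` — additive at `3` of Delbourgo type (G) with potentially SUPERSINGULAR reduction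
(`SubGss`: Kodaira I₀*, `e = 2`, the `χ₋₃`- or `χ₃`-twist of a good supersingular curve) — have the same Kummer torsor
at `3`, irrespective of the sub-cell (`a₃` of the good twist `= 0` or `= ±3`): both carry `V₁ = V₀ ⊗ ω` (v2 Thm 2,
`m = 2`) and the line is `ℓ₅*`, the conductor-5 step of the ramification filtration (v2 Thm 3 with `t = 1/2`:
upper break 5, torsor discriminant `d3 = 13`).  `W[3]|G_{ℚ₃}` is automatically irreducible here (twist of a
supersingular good curve), so no `LocIrr` hypothesis is needed.
Why it might fail: only through v2 Thm 3 at `t = 1/2` (valuation bookkeeping of `[3]T − T_K(P)` on the good model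
over `ℚ₃(3^{1/4})`); one KUM-DIFFERENT pair of I₀*-ss curves, or one I₀*-ss row with `d3 ≠ 13`, refutes it.
CHECK (2026-08-21, after the draft): v2 Thm 2 at `m = 2` and Thm 3 at `t = 1/2` CHECKED R5/R6 ✓ by harvest-2 E90
(`gen42/E90-T19v2-check.md` 6aa1eb9937515da2; second-seat numerics kit j135711: six I₀*-ss curves ↦ `(e,f) = (9,1)`,
`d3 = 13`) — THEOREM-CANDIDATE; `@[conjecture]` tag kept until a kernel proof.  Numerical law: `O5TorsorDiscriminant` §4.
[evidence: census cell O5, o5-r1 GEN 6, P-K11 kit j135074 arms A + B1 + C0r: d3 = 13 and (e,f) = (9,1) on 9 744/9 744 census I₀*-ss rows (5 906 O5a₀ + 3 838 O5a±) and 750/750 random local curves; I₀* ~ I₀* KUM-EQUAL 400/400 census (200 O5a± vs the O5a₀ reference) + 500/500 random; 0 exceptions]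
[cite: Serre1979, Ch. XV §2 Thm. 2, Ch. IV §3] [cite: PoonenRains2012, Prop. 2.9 / §4] -/
@[conjecture] def KummerLineUniversalIzeroStarThree : Prop :=
  ∀ (W G : WeierstrassCurve ℚ) [W.IsElliptic] [W.IsGloballyMinimal] [G.IsElliptic] [G.IsGloballyMinimal],
    ClassO5 W 3 → SubGss W 3 → ClassO5 G 3 → SubGss G 3 →
      ∀ x y x' y' : ℚ_[3], IsKummerBasePointThree W x y → IsKummerBasePointThree G x' y' →
        KummerTorsorsAgreeAtThree W G x x'

/-- **T22 `KummerLineTwistedClassesDifferThree` (CONJECTURE-class; DERIVED in `gen6/T19-PROOF-v2.md` Thms 3–4 pending check).**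
The two `V₁`-classes are DIFFERENT lines: a Kodaira-III O5(t′) curve `W` with irreducible local `W[3]` and an
I₀*-ss curve `G` never have agreeing Kummer torsors at `3` (`ℓ₇^iso ≠ ℓ₅*`: conductor exponents 7 ≠ 5), although
`W[3]|G_{ℚ₃} ≅ G[3]|G_{ℚ₃}` (`V₁`).  So a Selmer comparison between the two twisted Kodaira types must change the local
condition at `3` (by a known, fixed amount: both lines are isotropic lines of the same quadratic space).
Why it might fail: only with T20/T21; one KUM-EQUAL (III, I₀*) pair refutes it.
CHECK (2026-08-21, after the draft): v2 Thms 3–4 CHECKED R6/R7 ✓ by harvest-2 E90 (`gen42/E90-T19v2-check.md`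
6aa1eb9937515da2) — THEOREM-CANDIDATE; `@[conjecture]` tag kept until a kernel proof.
[evidence: census cell O5, o5-r1 GEN 6, P-K11 kit j135074 arms B3 + B4 + B5 + C3x + C0x: III ~ I₀* KUM-DIFFERENT 902/902, RHOBAR-MISMATCH 0; 0 exceptions]
[cite: Serre1979, Ch. XV §2 Thm. 2] -/
@[conjecture] def KummerLineTwistedClassesDifferThree : Prop :=
  ∀ (W G : WeierstrassCurve ℚ) [W.IsElliptic] [W.IsGloballyMinimal] [G.IsElliptic] [G.IsGloballyMinimal],
    ClassO5 W 3 → SubTprime W 3 → LocIrr W 3 → padicValRat 3 W.Δ = 3 →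
    ClassO5 G 3 → SubGss G 3 →
      ∀ x y x' y' : ℚ_[3], IsKummerBasePointThree W x y → IsKummerBasePointThree G x' y' →
        ¬ KummerTorsorsAgreeAtThree W G x x'

/-! ## Links (PROVED bookkeeping) -/

/-- **The `V₁` trichotomy for a triple** (III-LocIrr `W`, III-LocIrr `W'`, I₀*-ss `G`), read off T20 and T22:
`W ~ W'` agree and `W ~ G` disagree — the shape in which o5-r2's Selmer-structure comparisons consume the two
nodes ("the 3-part of a comparison is `0` within a Kodaira symbol and a fixed isotropic-line swap across
III ↔ I₀*"). [folklore] -/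
theorem kummerTorsors_typeIII_agree_and_differ_izeroStar
    (h20 : KummerLineUniversalTypeIIIThree) (h22 : KummerLineTwistedClassesDifferThree)
    (W W' G : WeierstrassCurve ℚ) [W.IsElliptic] [W.IsGloballyMinimal] [W'.IsElliptic] [W'.IsGloballyMinimal]
    [G.IsElliptic] [G.IsGloballyMinimal]
    (hW : ClassO5 W 3) (htW : SubTprime W 3) (hLW : LocIrr W 3) (hΔW : padicValRat 3 W.Δ = 3)
    (hW' : ClassO5 W' 3) (htW' : SubTprime W' 3) (hLW' : LocIrr W' 3) (hΔW' : padicValRat 3 W'.Δ = 3)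
    (hG : ClassO5 G 3) (hsG : SubGss G 3)
    (x y x' y' u v : ℚ_[3]) (hP : IsKummerBasePointThree W x y) (hP' : IsKummerBasePointThree W' x' y')
    (hQ : IsKummerBasePointThree G u v) :
    KummerTorsorsAgreeAtThree W W' x x' ∧ ¬ KummerTorsorsAgreeAtThree W G x u :=
  ⟨h20 W W' hW htW hLW hΔW hW' htW' hLW' hΔW' x y x' y' hP hP',
    h22 W G hW htW hLW hΔW hG hsG x y u v hP hQ⟩

end Summit.BirchSwinnertonDyer.Rank1Residual.O5
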